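/-
Copyright (c) 2026 the pub-hodgecm-mathlib formalisation cell (harness21).  Prover seat hodgecm-mathlib-K2Liu-p06 (g3): Track B «K2-LIT»,
hLiu418 = stmt-HodgeConjecture-24832; LEAD F0P6-plan (g12) 07:30:49Z «THEN (b) the CURVE-FRAME corollary of Φ2»; 2026-09-04.
-/
import Summits.HodgeConjecture.HodgeConjecture.Theorems.K2LiuSiegelEisensteinCoeffNondegenerate   -- ★ Φ2 assembly
import Literature.NumberTheory.K2Lit.SiegelStandardSections                                       -- ★ `IsStandardSectionFamily`
import HarnessLib

/-!
# Crux `HLiu418`, ROAD Φ, organ Φ2 at the CURVE FRAME of socket #41: for a standard section family `f` on the quasi-split `U(2,2)` of the K2_Liu frame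
# (`e : Fin 2 × Fin 1 ≃ Fin n`) and a non-degenerate `T_L`-skew index `S`, `E_S(h; f_s) = (∫β)⁻¹ · W_S(f_s)(h)`

Cell `hodgecm-mathlib`, crux item hLiu418 = `stmt-HodgeConjecture-24832`; squad K2 ∕ K2Liu, LEAD F0P6-plan (g12), prover K2Liu-p06 (g3).  THEOREMS ONLY; lane
`--supports stmt-HodgeConjecture-24832 --as helper` (count-neutral).

WHAT.  ★ `K2LiuSiegelEisensteinCoeffNondegenerate.fourierCoeffDelta_eisensteinSeriesDelta_eq` at the frame of record of RULING «M-155l» (1a) = the binder prefix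
of socket #41 `sig_K2LiuSiegelEisensteinContinuation` (`{n} (e : Fin 2 × Fin 1 ≃ Fin n) (dV : Fin 2 → L) … (dW : Fin 1 → L) …`, a STANDARD section family
`f` of ★ `IsStandardSectionFamily 𝒦 χ f`, `∀ s, Continuous (f s)`): `card_curveFrame` discharges `0 < n` (`n = 2`), the family member `f s` is a Siegel section of
`I_Δ(s, χ)` (`IsStandardSectionFamily.1.1 s`), and **`fourierCoeffDelta_eisensteinFamilyDelta_eq_curve`**: under the binder (H) of ★ O41.4 at `(f s, h)`,
`fourierCoeffDelta νN β S (eisensteinFamilyDelta f s) h = ((∫⁻ β ∂νN).toReal⁻¹ : ℝ) • whittakerDelta νN S (f s) h` for every `T_L`-skew `S` with `det S ≠ 0` —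
by name for the Road-Φ assembly of #41 (Φ9).  [KudlaRallis1994, §2], [Tan1999, §3], [Shimura1997, §18.3].

HONEST LABEL.  Count-neutral helper; `HC_CM` is proved only modulo the 7 printed citations (2 remaining named inputs: hLiu418 = `stmt-HodgeConjecture-24832`,
h413 = `stmt-HodgeConjecture-24833`) until rung 0 closes.
-/

set_option autoImplicit false
set_option linter.dupNamespace false -- the mandated namespace repeats `HodgeConjecture.HodgeConjecture`

noncomputable section

open scoped Matrix ENNReal NNReal ComplexConjugate
open NumberField IsDedekindDomain MeasureTheory MeasureTheory.Measure Filter Set Function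
open Literature.NumberTheory.Automorphic Literature.NumberTheory.Automorphic.UnitaryGroup Literature.NumberTheory.GaloisRepresentations
open Literature.NumberTheory.GelbartRogawski1991 Literature.NumberTheory.GelbartRogawski1991.GRConstruction
open Literature.NumberTheory.K2Lit.SiegelDoubled Literature.MeasureTheory.Group
open UnitaryDualPair

namespace Summit.HodgeConjecture.HodgeConjecture.Cruxes.HLiu418.K2LiuSiegelEisensteinCoeffNondegenerateCurve

open K2LiuUnipotentCoveringWeight K2LiuSiegelUnipotentFourierDefs K2LiuSiegelEisensteinCoeffOrbitSum K2LiuSiegelEisensteinCoeffNondegenerate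

variable {L : Type} [Field L] [NumberField L] [IsCMField L]

/-- the curve frame has `n = 2`, in particular `0 < n`. [folklore] -/
theorem card_curveFrame {n : ℕ} (e : Fin 2 × Fin 1 ≃ Fin n) : n = 2 ∧ 0 < n := by
  have h : Fintype.card (Fin 2 × Fin 1) = Fintype.card (Fin n) := Fintype.card_congr e
  simp only [Fintype.card_prod, Fintype.card_fin] at h
  omega

/-- **Φ2 AT THE CURVE FRAME: `E_S(h; f_s) = (∫ β)⁻¹ · W_S(f_s)(h)` for `det S ≠ 0`** — binder prefix of socket #41 (quasi-split `U(2,2)` of the K2_Liu frame,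
`𝒦` an Iwasawa datum, `f` a STANDARD section family for `χ`, continuous in `h`), `νN` a left-invariant measure on `N_Δ(𝔸)`, `β` an `N_Δ(L⁺)`-covering weight, the
`w_Δ`-orbit presentation `wq`, `h ∈ H(𝔸)`, the binder (H) of ★ O41.4 at `(f s, h)`, `S` `T_L`-skew with `det S ≠ 0`.  (★ `fourierCoeffDelta_eisensteinSeriesDelta_eq`
with `0 < n` from `card_curveFrame` and the section property `IsStandardSectionFamily.1.1 s`.) [cite: KudlaRallis1994, §2] [cite: Tan1999, §3] [cite: Shimura1997, §18.3] -/
theorem fourierCoeffDelta_eisensteinFamilyDelta_eq_curve {n : ℕ} (e : Fin 2 × Fin 1 ≃ Fin n)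
    (dV : Fin 2 → L) (hdV : ∀ i, IsCMField.complexConj L (dV i) = dV i) (hdV0 : ∀ i, dV i ≠ 0)
    (dW : Fin 1 → L) (hdW : ∀ i, IsCMField.complexConj L (dW i) = dW i) (hdW0 : ∀ i, dW i ≠ 0)
    (𝒦 : IwasawaDatum L e dV hdV dW hdW) {χ : HeckeCharacter L} {f : ℂ → HA L e dV hdV dW hdW → ℂ}
    (hf : IsStandardSectionFamily 𝒦 χ f) (hfc : ∀ s, Continuous (f s))
    (wq : unipDeltaRat L e dV hdV dW hdW → ratH L e dV hdV dW hdW)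
    (hwq : ∀ ν, ((wq ν : ratH L e dV hdV dW hdW) : HA L e dV hdV dW hdW) =
      weylDelta L e dV hdV dW hdW * ((ν : unipDelta L e dV hdV dW hdW) : HA L e dV hdV dW hdW))
    [MeasurableSpace (unipDelta L e dV hdV dW hdW)] [BorelSpace (unipDelta L e dV hdV dW hdW)]
    (νN : Measure (unipDelta L e dV hdV dW hdW)) [νN.IsMulLeftInvariant]
    {β : unipDelta L e dV hdV dW hdW → ℝ≥0∞} (hβ : IsCoveringWeight (unipDeltaRat L e dV hdV dW hdW) β)
    (s : ℂ) (h : HA L e dV hdV dW hdW)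
    (hH : ∫⁻ u, (∑' q : SiegelDeltaQuot L e dV hdV dW hdW,
        ‖f s ((((Quotient.out q : ratH L e dV hdV dW hdW) : HA L e dV hdV dW hdW)) * ((u : HA L e dV hdV dW hdW) * h))‖ₑ) * β u ∂νN ≠ ∞)
    {S : Matrix (Fin n) (Fin n) L}
    (hS : S ∈ skewMatrices ((IsCMField.complexConj L : L ≃ₐ[Fp L] L) : L →+* L) ((gramR L e dV hdV dW hdW).map (algebraMap (Fp L) L))) (hdet : S.det ≠ 0) :
    fourierCoeffDelta L e dV hdV dW hdW νN β S (eisensteinFamilyDelta L e dV hdV dW hdW f s) h =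
      ((∫⁻ u, β u ∂νN).toReal⁻¹ : ℝ) • whittakerDelta L e dV hdV dW hdW νN S (f s) h := by
  have hE : eisensteinFamilyDelta L e dV hdV dW hdW f s = eisensteinSeriesDelta L e dV hdV dW hdW (f s) := rfl
  rw [hE]
  exact fourierCoeffDelta_eisensteinSeriesDelta_eq wq hwq hdV0 hdW0 (card_curveFrame e).2 νN hβ (hf.1.1 s) (hfc s) h hH hS hdet

end Summit.HodgeConjecture.HodgeConjecture.Cruxes.HLiu418.K2LiuSiegelEisensteinCoeffNondegenerateCurve

end
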